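import Summits.AtomisticToContinuum.HydrodynamicLimit.Theorems.CollisionIsometryCLTMacroClosureFvMixingParamsA
import HarnessLib

/-!
# Sub-goal `fv_mixing_params` of the lead's stub `stub_hsFreeEnergyConvex` (line
# `IdeatorTwoGen1Sketch`, crux `MacroClosure`, stmt-AtomisticToContinuum-14870)

Support file (`--supports stmt-AtomisticToContinuum-14870`) proving the registered sub-goal
`Barycentric.fv_mixing_params` (S5, mixing parameters): for all large `N`, existence of the
cell/occupation bookkeeping of the sub-cube decomposition lower bound of the hard-sphere free
volume at density `η = α η₁ + (1 - α) η₂`: a `k³` grid (`k = ⌊N^{1/15}⌋₊ + 2`) of cubes of side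
`s = 1/k - (η/N)^{1/3}`, `J₁ = ⌊α (k³ - 1)⌋₊` cubes at local density `≤ η₁`, `J₂ = k³ - 2 - J₁`
cubes at density `≤ η₂`, one fractional cube (density `η₄ = θ η₁ + (1 - θ) η₂ ≤ η₂`,
`θ = α (k³ - 1) - J₁`) absorbing the non-integrality of `α (k³ - 1)`, and one overflow cube
carrying the remaining `R` particles at density `≤ 6/5`; the entropy-of-mixing weights are within
`ε` of `α η₁ / η`, `(1 - α) η₂ / η`, all occupation numbers exceed the threshold `N₀`, the two
special cubes carry `≤ ε N` particles, and the Stirling budget `k³ (log N + 2) ≤ ε N` holds.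

* `FvMixingParams.core` — assembly of the occupation numbers for one good `N` from the corridor
  algebra (`FvMixingParams.env`) and the bounds `FvMixingParams.overflow`,
  `fv_mixing_params_weight` of the helpers file A;
* `fv_mixing_params` — the registered statement (eventually in `N`, via `t = N^{1/15} → ∞`).
-/

noncomputable section

open Filter Set Topology

namespace Summit.AtomisticToContinuum.HydrodynamicLimit.Theorems.MacroClosureLine

namespace Barycentric

namespace FvMixingParams

/-- Assembly of the occupation numbers for one good `N`: `J₁ = ⌊α (k³ - 1)⌋₊`,
`J₂ = k³ - 2 - J₁`, `nᵢ = ⌊ηᵢ s³ N / η⌋₊` (`η₄ = θ η₁ + (1 - θ) η₂`, `θ = α (k³ - 1) - J₁`) and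
`R = N - (J₁ n₁ + J₂ n₂ + n₄)`. -/
theorem core (η₁ η₂ α η δ ε : ℝ) (N₀ N k : ℕ) (d s : ℝ) (h₁ : 0 < η₁) (h₁₂ : η₁ < η₂)
    (h₂ : η₂ < 11 / 10) (hα : 0 < α) (hα₁ : α < 1) (hη : η = α * η₁ + (1 - α) * η₂)
    (hδ : 0 < δ) (hδ1 : δ ≤ 1 / 352) (hδ2 : 6 * δ ≤ ε) (hδ3 : δ * (N₀ + 2) * η₂ ≤ η₁)
    (hδ4 : 6 * δ * η₂ ≤ ε * η₁) (hk : 2 ≤ k) (hd : 0 ≤ d) (hs : s = 1 / (k : ℝ) - d)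
    (hdk : d * (k : ℝ) ^ 4 ≤ δ) (hk6 : (k : ℝ) ^ 6 ≤ δ * N) (hk1 : 1 / (k : ℝ) ≤ δ) :
    ∃ J₁ J₂ n₁ n₂ n₄ R : ℕ, 0 < s ∧ J₁ + J₂ + 2 = k ^ 3 ∧ J₁ * n₁ + J₂ * n₂ + n₄ + R = N ∧
      N₀ ≤ n₁ ∧ N₀ ≤ n₂ ∧ N₀ ≤ n₄ ∧ N₀ ≤ R ∧ (n₁ : ℝ) * η ≤ η₁ * s ^ 3 * N ∧
      (n₂ : ℝ) * η ≤ η₂ * s ^ 3 * N ∧ (n₄ : ℝ) * η ≤ η₂ * s ^ 3 * N ∧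
      (R : ℝ) * η ≤ 6 / 5 * s ^ 3 * N ∧ (R : ℝ) ≤ 2 * s ^ 3 * N ∧ (n₄ : ℝ) ≤ ε * N ∧
      (R : ℝ) ≤ ε * N ∧ |(J₁ : ℝ) * n₁ / N - α * η₁ / η| ≤ ε ∧
      |(J₂ : ℝ) * n₂ / N - (1 - α) * η₂ / η| ≤ ε := by
  obtain ⟨hN, hs0, hdkδ, e2, e3, e4, e5, e6, e7, e3'⟩ :=
    env (k : ℝ) d δ N s (by exact_mod_cast hk) hd hδ hδ1 hdk hk6 hk1 hs
  -- the density `η`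
  have h₂0 : 0 < η₂ := by linarith only [h₁, h₁₂]
  have hη₁η : η₁ < η := by
    have := mul_pos (sub_pos.2 hα₁) (sub_pos.2 h₁₂)
    linarith only [hη, this]
  have hηη₂ : η < η₂ := by
    have := mul_pos hα (sub_pos.2 h₁₂)
    linarith only [hη, this]
  have hη0 : 0 < η := by linarith only [h₁, hη₁η]
  have hη11 : η < 11 / 10 := by linarith only [hηη₂, h₂]
  have hε : 0 < ε := by linarith only [hδ, hδ2]
  -- the cell volume scale `S = s³ N` and `M = S / η`
  obtain ⟨S, hSdef⟩ : ∃ S : ℝ, S = s ^ 3 * N := ⟨_, rfl⟩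
  rw [← hSdef] at e2 e3 e4 e5 e6 e3'
  have hSc : ∀ c : ℝ, c * s ^ 3 * N = c * S := fun c => by rw [hSdef]; ring
  have hS0 : 0 < S := by rw [hSdef]; exact mul_pos (pow_pos hs0 3) hN
  obtain ⟨M, hM⟩ : ∃ M : ℝ, M = S / η := ⟨_, rfl⟩
  have hMS : M * η = S := by rw [hM]; exact div_mul_cancel₀ S hη0.ne'
  have hM0 : 0 < M := by rw [hM]; exact div_pos hS0 hη0
  -- the cells `J₁`, `J₂`
  obtain ⟨hJk, hJ₁hi, hJ₁lo⟩ := jfacts α k hα hα₁ hk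
  obtain ⟨J₁, hJ₁⟩ : ∃ J₁ : ℕ, J₁ = ⌊α * ((k : ℝ) ^ 3 - 1)⌋₊ := ⟨_, rfl⟩
  rw [← hJ₁] at hJk hJ₁hi hJ₁lo
  obtain ⟨J₂, hJ₂⟩ : ∃ J₂ : ℕ, J₂ = k ^ 3 - 2 - J₁ := ⟨_, rfl⟩
  have hJsum : J₁ + J₂ + 2 = k ^ 3 := by omega
  have hJsumr : (J₁ : ℝ) + J₂ + 2 = (k : ℝ) ^ 3 := by exact_mod_cast hJsum
  have hJ₂r : (J₂ : ℝ) = (k : ℝ) ^ 3 - 2 - J₁ := by linarith only [hJsumr]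
  have hJ₁0 : (0 : ℝ) ≤ J₁ := Nat.cast_nonneg _
  have hJ₂0 : (0 : ℝ) ≤ J₂ := Nat.cast_nonneg _
  -- the fractional density `η₄`
  obtain ⟨θ, hθ⟩ : ∃ θ : ℝ, θ = α * ((k : ℝ) ^ 3 - 1) - J₁ := ⟨_, rfl⟩
  have hθ0 : 0 ≤ θ := by linarith only [hθ, hJ₁hi]
  have hθ1 : θ ≤ 1 := by linarith only [hθ, hJ₁lo]
  obtain ⟨η₄, hη₄⟩ : ∃ η₄ : ℝ, η₄ = θ * η₁ + (1 - θ) * η₂ := ⟨_, rfl⟩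
  have hη₄lo : η₁ ≤ η₄ := by
    have := mul_nonneg (sub_nonneg.2 hθ1) (sub_nonneg.2 h₁₂.le)
    linarith only [hη₄, this]
  have hη₄hi : η₄ ≤ η₂ := by
    have := mul_nonneg hθ0 (sub_nonneg.2 h₁₂.le)
    linarith only [hη₄, this]
  have hη₄0 : 0 < η₄ := by linarith only [h₁, hη₄lo]
  -- the occupation numbers
  obtain ⟨n₁, hn₁⟩ : ∃ n₁ : ℕ, n₁ = ⌊η₁ * M⌋₊ := ⟨_, rfl⟩
  obtain ⟨n₂, hn₂⟩ : ∃ n₂ : ℕ, n₂ = ⌊η₂ * M⌋₊ := ⟨_, rfl⟩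
  obtain ⟨n₄, hn₄⟩ : ∃ n₄ : ℕ, n₄ = ⌊η₄ * M⌋₊ := ⟨_, rfl⟩
  have hn₁hi : (n₁ : ℝ) ≤ η₁ * M := by
    rw [hn₁]; exact Nat.floor_le (mul_nonneg h₁.le hM0.le)
  have hn₂hi : (n₂ : ℝ) ≤ η₂ * M := by
    rw [hn₂]; exact Nat.floor_le (mul_nonneg h₂0.le hM0.le)
  have hn₄hi : (n₄ : ℝ) ≤ η₄ * M := by
    rw [hn₄]; exact Nat.floor_le (mul_nonneg hη₄0.le hM0.le)
  have hn₁lo : η₁ * M - 1 ≤ n₁ := by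
    rw [hn₁]; have := Nat.lt_floor_add_one (η₁ * M); linarith only [this]
  have hn₂lo : η₂ * M - 1 ≤ n₂ := by
    rw [hn₂]; have := Nat.lt_floor_add_one (η₂ * M); linarith only [this]
  have hn₄lo : η₄ * M - 1 ≤ n₄ := by
    rw [hn₄]; have := Nat.lt_floor_add_one (η₄ * M); linarith only [this]
  -- thresholds: `N₀ + 2 ≤ η₁ M`
  have hN₀0 : (0 : ℝ) ≤ N₀ := Nat.cast_nonneg _
  have hbase : (N₀ : ℝ) + 2 ≤ η₁ * M := by
    have a1 : ((N₀ : ℝ) + 2) * η ≤ ((N₀ : ℝ) + 2) * η₂ :=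
      mul_le_mul_of_nonneg_left hηη₂.le (by linarith only [hN₀0])
    have a2 : ((N₀ : ℝ) + 2) * η₂ ≤ ((N₀ : ℝ) + 2) * η₂ * (δ * S) :=
      le_mul_of_one_le_right (mul_nonneg (by linarith only [hN₀0]) h₂0.le) e5
    have a3 : ((N₀ : ℝ) + 2) * η₂ * (δ * S) = (δ * (N₀ + 2) * η₂) * S := by ring
    have a4 : (δ * (N₀ + 2) * η₂) * S ≤ η₁ * S := mul_le_mul_of_nonneg_right hδ3 hS0.le
    have a5 : η₁ * S = (η₁ * M) * η := by rw [← hMS]; ring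
    have a6 : ((N₀ : ℝ) + 2) * η ≤ (η₁ * M) * η := by linarith only [a1, a2, a3, a4, a5]
    exact le_of_mul_le_mul_right a6 hη0
  have hM12 : η₁ * M ≤ η₂ * M := mul_le_mul_of_nonneg_right h₁₂.le hM0.le
  have hM14 : η₁ * M ≤ η₄ * M := mul_le_mul_of_nonneg_right hη₄lo hM0.le
  -- the typed total `T` and the overflow `R`
  obtain ⟨T, hT⟩ : ∃ T : ℕ, T = J₁ * n₁ + J₂ * n₂ + n₄ := ⟨_, rfl⟩
  have hTr : (T : ℝ) = J₁ * n₁ + J₂ * n₂ + n₄ := by rw [hT]; push_cast; ring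
  have hid : (J₁ : ℝ) * η₁ + J₂ * η₂ + η₄ = ((k : ℝ) ^ 3 - 1) * η := by
    rw [hJ₂r, hη₄, hθ, hη]; ring
  have hTup : (T : ℝ) ≤ ((k : ℝ) ^ 3 - 1) * S := by
    have b1 : (J₁ : ℝ) * n₁ ≤ J₁ * (η₁ * M) := mul_le_mul_of_nonneg_left hn₁hi hJ₁0
    have b2 : (J₂ : ℝ) * n₂ ≤ J₂ * (η₂ * M) := mul_le_mul_of_nonneg_left hn₂hi hJ₂0
    have b3 : (J₁ : ℝ) * (η₁ * M) + J₂ * (η₂ * M) + η₄ * M = ((k : ℝ) ^ 3 - 1) * S := by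
      calc (J₁ : ℝ) * (η₁ * M) + J₂ * (η₂ * M) + η₄ * M
          = ((J₁ : ℝ) * η₁ + J₂ * η₂ + η₄) * M := by ring
        _ = ((k : ℝ) ^ 3 - 1) * η * M := by rw [hid]
        _ = ((k : ℝ) ^ 3 - 1) * S := by rw [← hMS]; ring
    linarith only [hTr, b1, b2, b3, hn₄hi]
  have hTlo : ((k : ℝ) ^ 3 - 1) * S - ((k : ℝ) ^ 3 - 1) ≤ (T : ℝ) := by
    have b1 : (J₁ : ℝ) * (η₁ * M - 1) ≤ J₁ * n₁ := mul_le_mul_of_nonneg_left hn₁lo hJ₁0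
    have b2 : (J₂ : ℝ) * (η₂ * M - 1) ≤ J₂ * n₂ := mul_le_mul_of_nonneg_left hn₂lo hJ₂0
    have b3 : (J₁ : ℝ) * (η₁ * M - 1) + J₂ * (η₂ * M - 1) + (η₄ * M - 1) =
        ((k : ℝ) ^ 3 - 1) * S - ((k : ℝ) ^ 3 - 1) := by
      calc (J₁ : ℝ) * (η₁ * M - 1) + J₂ * (η₂ * M - 1) + (η₄ * M - 1)
          = ((J₁ : ℝ) * η₁ + J₂ * η₂ + η₄) * M - ((J₁ : ℝ) + J₂ + 2 - 1) := by ring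
        _ = ((k : ℝ) ^ 3 - 1) * η * M - ((k : ℝ) ^ 3 - 1) := by rw [hid, hJsumr]
        _ = ((k : ℝ) ^ 3 - 1) * S - ((k : ℝ) ^ 3 - 1) := by rw [← hMS]; ring
    linarith only [hTr, b1, b2, b3, hn₄lo]
  have hTleN : (T : ℝ) ≤ N := by linarith only [hTup, e2, hS0]
  have hTN : T ≤ N := by exact_mod_cast hTleN
  obtain ⟨R, hR⟩ : ∃ R : ℕ, R = N - T := ⟨_, rfl⟩
  have hRr : (R : ℝ) = N - T := by rw [hR, Nat.cast_sub hTN]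
  have hRS : S ≤ R := by linarith only [hRr, hTup, e2, hS0]
  -- the overflow bounds
  obtain ⟨r1, r2, r3⟩ := overflow R T S N ((k : ℝ) ^ 3) (d * k) δ ε η hη0 hη11 hN.le
    (pow_pos (by exact_mod_cast (lt_of_lt_of_le (by norm_num : 0 < 2) hk)) 3) hS0.le hδ.le hδ1
    hδ2 hRr hTlo e3' e4 hdkδ
    (by calc d * k * (k : ℝ) ^ 3 = d * (k : ℝ) ^ 4 := by ring
          _ ≤ δ := hdk)
    (by calc (k : ℝ) ^ 3 * (k : ℝ) ^ 3 = (k : ℝ) ^ 6 := by ring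
          _ ≤ δ * N := hk6) e6 e7
  refine ⟨J₁, J₂, n₁, n₂, n₄, R, hs0, hJsum, by omega, ?_, ?_, ?_, ?_, ?_, ?_, ?_, ?_, ?_, ?_,
    ?_, ?_, ?_⟩
  · -- `N₀ ≤ n₁`
    rw [hn₁]; exact Nat.le_floor (by linarith only [hbase])
  · -- `N₀ ≤ n₂`
    rw [hn₂]; exact Nat.le_floor (by linarith only [hbase, hM12])
  · -- `N₀ ≤ n₄`
    rw [hn₄]; exact Nat.le_floor (by linarith only [hbase, hM14])
  · -- `N₀ ≤ R`
    have a0 : η₂ ≤ η₂ * (δ * S) := le_mul_of_one_le_right h₂0.le e5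
    have a1 : δ * ((N₀ : ℝ) + 2) * η₂ < δ * S * η₂ := by linarith only [hδ3, h₁₂, a0]
    have a2 : δ * ((N₀ : ℝ) + 2) < δ * S := lt_of_mul_lt_mul_right a1 h₂0.le
    have a3 : (N₀ : ℝ) + 2 < S := lt_of_mul_lt_mul_left a2 hδ.le
    have a4 : (N₀ : ℝ) ≤ R := by linarith only [a3, hRS]
    exact_mod_cast a4
  · -- `n₁ η ≤ η₁ s³ N`
    rw [hSc]
    calc (n₁ : ℝ) * η ≤ η₁ * M * η := mul_le_mul_of_nonneg_right hn₁hi hη0.le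
      _ = η₁ * S := by rw [mul_assoc, hMS]
  · -- `n₂ η ≤ η₂ s³ N`
    rw [hSc]
    calc (n₂ : ℝ) * η ≤ η₂ * M * η := mul_le_mul_of_nonneg_right hn₂hi hη0.le
      _ = η₂ * S := by rw [mul_assoc, hMS]
  · -- `n₄ η ≤ η₂ s³ N`
    rw [hSc]
    calc (n₄ : ℝ) * η ≤ η₄ * M * η := mul_le_mul_of_nonneg_right hn₄hi hη0.le
      _ = η₄ * S := by rw [mul_assoc, hMS]
      _ ≤ η₂ * S := mul_le_mul_of_nonneg_right hη₄hi hS0.le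
  · -- `R η ≤ 6/5 s³ N`
    rw [hSc]; exact r1
  · -- `R ≤ 2 s³ N`
    rw [hSc]; exact r2
  · -- `n₄ ≤ ε N`
    have a1 : (n₄ : ℝ) * η ≤ η₂ * S := by
      calc (n₄ : ℝ) * η ≤ η₄ * M * η := mul_le_mul_of_nonneg_right hn₄hi hη0.le
        _ = η₄ * S := by rw [mul_assoc, hMS]
        _ ≤ η₂ * S := mul_le_mul_of_nonneg_right hη₄hi hS0.le
    have a2 : η₂ * S ≤ η₂ * (δ * N) := mul_le_mul_of_nonneg_left e6 h₂0.le
    have a3 : δ * η₂ ≤ ε * η := by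
      have w1 := mul_pos hδ h₂0
      have w2 := mul_le_mul_of_nonneg_left hη₁η.le hε.le
      linarith only [hδ4, w1, w2]
    have a4 : δ * η₂ * N ≤ ε * η * N := mul_le_mul_of_nonneg_right a3 hN.le
    refine le_of_mul_le_mul_right ?_ hη0
    linarith only [a1, a2, a4]
  · -- `R ≤ ε N`
    exact r3
  · -- weight of the `η₁` cells
    have w1 : δ * η₁ ≤ δ * η := mul_le_mul_of_nonneg_left hη₁η.le hδ.le
    have w2 : 6 * δ * η ≤ ε * η := mul_le_mul_of_nonneg_right hδ2 hη0.le
    exact fv_mixing_params_weight J₁ n₁ M S N η η₁ α ((k : ℝ) ^ 3) δ ε hη0 hN hα.le hα₁.le h₁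
      hδ.le hJ₁0 (by linarith only [hJ₁lo]) hJ₁hi hn₁hi hn₁lo (by linarith only [hbase, hN₀0])
      hMS hS0.le e2 e3 e6 e7 (by linarith only [w1, w2])
  · -- weight of the `η₂` cells
    have w1 : δ * η ≤ δ * η₂ := mul_le_mul_of_nonneg_left hηη₂.le hδ.le
    have w2 : ε * η₁ ≤ ε * η := mul_le_mul_of_nonneg_left hη₁η.le hε.le
    exact fv_mixing_params_weight J₂ n₂ M S N η η₂ (1 - α) ((k : ℝ) ^ 3) δ ε hη0 hN
      (by linarith only [hα₁]) (by linarith only [hα]) h₂0 hδ.le hJ₂0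
      (by linarith only [hJ₂r, hJ₁hi]) (by linarith only [hJ₂r, hJ₁lo]) hn₂hi hn₂lo
      (by linarith only [hbase, hN₀0, hM12]) hMS hS0.le e2 e3 e6 e7
      (by linarith only [w1, w2, hδ4])

end FvMixingParams

/-- **S5 (mixing parameters).** For `η = α η₁ + (1 - α) η₂` with `0 < η₁ < η₂ < 11/10`,
`0 < α < 1`, a threshold `N₀` and `ε > 0`: for all large `N` there are a grid size `k ≥ 2`
(`k = ⌊N^{1/15}⌋₊ + 2`), cell counts `J₁ + J₂ + 2 = k³`, occupation numbers `n₁, n₂, n₄, R ≥ N₀`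
summing (with multiplicities) to `N`, at local densities `≤ η₁, η₂, η₂, 6/5` in cubes of side
`s = 1/k - (η/N)^{1/3} > 0`, with vanishing fractions `n₄, R ≤ ε N`, `R ≤ 2 s³ N`, mixing weights
`J₁ n₁ / N`, `J₂ n₂ / N` within `ε` of `α η₁ / η`, `(1 - α) η₂ / η`, and Stirling budget
`k³ (log N + 2) ≤ ε N`. -/
theorem fv_mixing_params : ∀ (η₁ η₂ α : ℝ), 0 < η₁ → η₁ < η₂ → η₂ < 11 / 10 → 0 < α → α < 1 →
    ∀ (N₀ : ℕ) (ε : ℝ), 0 < ε → ∀ᶠ N : ℕ in atTop, ∃ (k J₁ J₂ n₁ n₂ n₄ R : ℕ) (s : ℝ),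
    s = 1 / (k : ℝ) - ((α * η₁ + (1 - α) * η₂) / N) ^ (1 / 3 : ℝ) ∧ 2 ≤ k ∧ 0 < s ∧
    J₁ + J₂ + 2 = k ^ 3 ∧ J₁ * n₁ + J₂ * n₂ + n₄ + R = N ∧ N₀ ≤ n₁ ∧ N₀ ≤ n₂ ∧ N₀ ≤ n₄ ∧
    N₀ ≤ R ∧ (n₁ : ℝ) * (α * η₁ + (1 - α) * η₂) ≤ η₁ * s ^ 3 * N ∧
    (n₂ : ℝ) * (α * η₁ + (1 - α) * η₂) ≤ η₂ * s ^ 3 * N ∧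
    (n₄ : ℝ) * (α * η₁ + (1 - α) * η₂) ≤ η₂ * s ^ 3 * N ∧
    (R : ℝ) * (α * η₁ + (1 - α) * η₂) ≤ 6 / 5 * s ^ 3 * N ∧ (R : ℝ) ≤ 2 * s ^ 3 * N ∧
    (n₄ : ℝ) ≤ ε * N ∧ (R : ℝ) ≤ ε * N ∧
    |(J₁ : ℝ) * n₁ / N - α * η₁ / (α * η₁ + (1 - α) * η₂)| ≤ ε ∧
    |(J₂ : ℝ) * n₂ / N - (1 - α) * η₂ / (α * η₁ + (1 - α) * η₂)| ≤ ε ∧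
    (k : ℝ) ^ 3 * (Real.log N + 2) ≤ ε * N := by
  intro η₁ η₂ α h₁ h₁₂ h₂ hα hα₁ N₀ ε hε
  obtain ⟨η, hη⟩ : ∃ η : ℝ, η = α * η₁ + (1 - α) * η₂ := ⟨_, rfl⟩
  have hη₁η : η₁ < η := by
    have := mul_pos (sub_pos.2 hα₁) (sub_pos.2 h₁₂)
    linarith only [hη, this]
  have hηη₂ : η < η₂ := by
    have := mul_pos hα (sub_pos.2 h₁₂)
    linarith only [hη, this]
  have hη0 : 0 < η := by linarith only [h₁, hη₁η]
  have hη2 : η < 2 := by linarith only [hηη₂, h₂]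
  obtain ⟨δ, hδ, hδ1, hδ2, hδ3, hδ4⟩ :=
    FvMixingParams.exists_delta η₁ η₂ ε N₀ h₁ (by linarith only [h₁, h₁₂]) hε
  obtain ⟨T₀, hT₀⟩ : ∃ T₀ : ℝ, T₀ = max 1 (max (1062882 / δ) (405 / ε)) := ⟨_, rfl⟩
  have hT1 : 1 ≤ T₀ := by rw [hT₀]; exact le_max_left _ _
  have hTδ : 1062882 / δ ≤ T₀ := by
    rw [hT₀]; exact le_trans (le_max_left _ _) (le_max_right _ _)
  have hTε : 405 / ε ≤ T₀ := by
    rw [hT₀]; exact le_trans (le_max_right _ _) (le_max_right _ _)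
  have hev : ∀ᶠ N : ℕ in atTop, T₀ ≤ (N : ℝ) ^ (1 / 15 : ℝ) :=
    ((tendsto_rpow_atTop (by norm_num : (0 : ℝ) < 1 / 15)).comp
      tendsto_natCast_atTop_atTop).eventually_ge_atTop T₀
  filter_upwards [hev] with N hN
  obtain ⟨ht0, htN⟩ := FvMixingParams.rpow_pow_fifteen N
  obtain ⟨t, ht⟩ : ∃ t : ℝ, t = (N : ℝ) ^ (1 / 15 : ℝ) := ⟨_, rfl⟩
  rw [← ht] at hN ht0 htN
  obtain ⟨k, hk⟩ : ∃ k : ℕ, k = ⌊t⌋₊ + 2 := ⟨_, rfl⟩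
  have hk2 : 2 ≤ k := by omega
  have hkhi : (k : ℝ) ≤ t + 2 := by
    rw [hk]; push_cast; linarith only [Nat.floor_le ht0]
  have hklo : t ≤ k := by
    rw [hk]; push_cast; linarith only [Nat.lt_floor_add_one t]
  obtain ⟨h12, h6, h1k, hlog⟩ := FvMixingParams.poly_bounds t k N δ ε η T₀ hδ hε hη2 hT1 hTδ
    hTε hN hkhi hklo htN.symm
  have hN0 : (0 : ℝ) < N := by
    have a1 : (0 : ℝ) < (k : ℝ) ^ 6 := by positivity
    exact pos_of_mul_pos_right (lt_of_lt_of_le a1 h6) hδ.le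
  obtain ⟨d, hd⟩ : ∃ d : ℝ, d = (η / N) ^ (1 / 3 : ℝ) := ⟨_, rfl⟩
  have hd0 : 0 ≤ d := by rw [hd]; exact Real.rpow_nonneg (div_pos hη0 hN0).le _
  have hd3 : d ^ 3 = η / N := by
    rw [hd]; exact FvMixingParams.rpow_third_pow_three (η / N) (div_pos hη0 hN0).le
  have hdk : d * (k : ℝ) ^ 4 ≤ δ := by
    have h3 : (d * (k : ℝ) ^ 4) ^ 3 ≤ δ ^ 3 := by
      have a1 : (d * (k : ℝ) ^ 4) ^ 3 = η / N * (k : ℝ) ^ 12 := by rw [mul_pow, hd3]; ring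
      rw [a1, div_mul_eq_mul_div, div_le_iff₀ hN0]
      exact h12
    exact le_of_pow_le_pow_left₀ (by norm_num) hδ.le h3
  obtain ⟨J₁, J₂, n₁, n₂, n₄, R, hs0, hJ, hsum, c1, c2, c3, c4, c5, c6, c7, c8, c9, c10, c11,
    c12, c13⟩ := FvMixingParams.core η₁ η₂ α η δ ε N₀ N k d (1 / (k : ℝ) - d) h₁ h₁₂ h₂ hα hα₁
    hη hδ hδ1 hδ2 hδ3 hδ4 hk2 hd0 rfl hdk h6 h1k
  subst hη hd
  exact ⟨k, J₁, J₂, n₁, n₂, n₄, R, 1 / (k : ℝ) - ((α * η₁ + (1 - α) * η₂) / N) ^ (1 / 3 : ℝ),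
    rfl, hk2, hs0, hJ, hsum, c1, c2, c3, c4, c5, c6, c7, c8, c9, c10, c11, c12, c13, hlog⟩

end Barycentric

end Summit.AtomisticToContinuum.HydrodynamicLimit.Theorems.MacroClosureLine

end
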